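import Summits.BirchSwinnertonDyer.BirchSwinnertonDyer.Theorems.GenusKolyvaginAtTwoGenusPrimitiveSupplyAtTwoPosDiscShallowSwapTypeReadsDepthBit
import Summits.BirchSwinnertonDyer.BirchSwinnertonDyer.Theorems.GenusKolyvaginAtTwoGenusDeepSupplyAtTwoNegDiscNarrowDepthZeroInstance
import Summits.BirchSwinnertonDyer.BirchSwinnertonDyer.Theorems.GenusKolyvaginAtTwoGenusPrimitiveSupplyAtTwoConjugationTypeAtTwo
import Literature.NumberTheory.EllipticCurves.PointDivisibilityProofs
import HarnessLib

/-!
# Route `GenusKolyvaginAtTwo`, crux 25504 (and 23491), kernels K₄⁺ / K₄ at POSITIVE DEPTH: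
# THE SWAP-TYPE READING FRAME, INSTANTIATED ON THE CRUXES' CURRENCY — `w = y_K / 2^{M₀}` lies in `E(K)`, is `τ`-anti-invariant up to an
# `Aut(K/ℚ)`-fixed torsion point of ODD order, and the positive-depth bit of `…SwapTypeReadsDepthBit` is read at every Frobenius acting as `τ` on `K`

Seat `bsd-line-gk2-p5` g35 (cell `bsd-f1-sign2`, WIDTH-5 attach), `--supports stmt-BirchSwinnertonDyer-25504 --as helper`; sequel of p766882
(`…SwapTypeReadsDepthBit`: the abstract frame `2w′ = w`, `σw = −w + t`, `σt = t`, `t` odd, and its bit `σ•t₁ + t₁`).  THEOREMS ONLY; sign-free in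
`Δ_E` (serves K₄ on 23491 verbatim).  **BSD is NOT proved by this file, no item is closed, the registered stubs are untouched.**

Template = g33's `DepthZero.geomReduction_heegnerPoint_eq_of_two_pow_smul` (p762214): the equivariant embedding `e_* = Affine.Point.map (absEmbedding ℚ K) :
E(K) → E(ℚ̄)` (`DepthZero.smul_eq_map_absEmbedding_smul`: `γ • e_* X = e_* (τ • X)` whenever `γ` acts on `e(K)` as `τ`), Gross 5.3 ∕ Darmon 3.11
(`heegnerPoint_conj_add_rootNumber_smul_holds`: `τP + w(E)P` is torsion for a Heegner point `P ∈ E(K)`), McCallum's Lemma 5.1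
(`exists_pow_smul_eq_derivedPoint_one_iff`: `2`-power divisibility of `y_K = P(1)` is the same in `E(K[1])` and in `E(K)`).

* §1 `E(K)`-currency (`frame_of_two_pow_smul`): `P ∈ E(K)` Heegner, `w(E) = +1`, `E(K)[2] = 0`, `2^M • Q₀ = P` in `E(K)`, `γ ∈ Γ_ℚ` acting on
  `e(K)` as `τ ≠ 1`.  With **`u := τ•Q₀ + Q₀`**: `u` has finite order, is fixed by every `σ ∈ Aut(K/ℚ)`, `τ•Q₀ = −Q₀ + u`; transported:
  **`γ • e_*Q₀ = −e_*Q₀ + e_*u`, `γ • e_*u = e_*u`, `addOrderOf (e_*u)` ODD, and `e_*Q₀` has a half `w′ ∈ E(ℚ̄)`** — exactly the frame of p766882.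
* §2 cruxes' currency (`frame_of_depth`): habitat-type hypotheses `r_an(E) = 0` (⟹ `w = +1`), `ρ̄_{E,2}` onto ∧ `d_K Δ_E ∉ ℚ²` (⟹ `E(K[1])[2] = 0`),
  a conductor-`1` datum `d₁` and McCallum's `2^{M₀} ∣ P(1)` in `E(K[1])`: there are `P₀, Q₀ ∈ E(K)` with `P₀ ↦ P(1)`, `2^{M₀}Q₀ = P₀` and the §1
  frame at EVERY `γ` acting as `τ` on `K`.
* §3 READINGS at an arithmetic Frobenius `γ` of an odd good prime `p` with `2 ∣ a_p` acting as `τ` on `K` (the Frobenius of a Zhang–Kolyvagin prime at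
  `2`: `p` inert): **`exists_frobSq_fixed_half_iff_bit_eq_zero_of_frame`** — `red_p(e_*Q₀)` has an `𝔽_{p²}`-rational half iff the bit of `(γ, w′, e_*u)`
  vanishes; **`exists_frobSq_fixed_half_of_smul_torsion_eq_self_of_frame`** — if `γ` fixes `E[2]` pointwise (a `τ`-type Frobenius on `Δ > 0`) the half
  ALWAYS exists: such primes cannot see `y_K/2^{M₀}`.

* §4 BY THE SIGN OF `Δ` (`GenusKolySign.twoTorsion_smul_eq_of_Δ_pos`, `KolyvaginEigenTwo.exists_twoTorsion_smul_ne_of_Δ_neg`): an element agreeing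
  with complex conjugation on `E[2]` (Gross's (3.2) at level `2`) FIXES `E[2]` on `Δ > 0` (blind: `bit_eq_zero_of_agree_of_Δ_pos`,
  `exists_frobSq_fixed_half_of_agree_of_Δ_pos_of_depth`) and MOVES a `2`-torsion point on `Δ < 0` (`exists_smul_ne_of_agree_of_Δ_neg`: K₄'s
  classical deep primes are of transposition type).

READING.  The K₄⁺ clause «Frobenius MOVES a point of `E[2]`» (transposition type) is the only Frobenius class at a Zhang–Kolyvagin prime at `2`, `Δ > 0`,
at which the reduction of `y_K/2^{M₀}` carries information; instrument I3⁺ for -data = this bit.  Nothing here proves K₄⁺, K₄ or BSD.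

References: [GrossLMS1991] §3 Prop. 3.7, §4 (4.1), §5 Prop. 5.3, §6 Prop. 6.2; [McCallumLMS1991] §5 Lemma 5.1; [Darmon2004] Prop. 3.11;
[Serre1972] §1.11 Prop. 11; [SilvermanAEC2009] V.2.3.1, VII.3.1(b), VIII.§1–§2.
-/

set_option autoImplicit false
set_option linter.dupNamespace false -- `Summit.<P>.<Sub>` repeats `BirchSwinnertonDyer` (D-0017)

noncomputable section

open scoped Classical NumberField Pointwise

namespace Summit.BirchSwinnertonDyer.BirchSwinnertonDyer.Theorems.GenusSupplyNarrow.SwapRead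

open IsDedekindDomain Field NumberField WeierstrassCurve Literature.NumberTheory.EllipticCurves
  Literature.NumberTheory.EllipticCurves.ModularForms Literature.NumberTheory.GaloisRepresentations Rat.HeightOneSpectrum
  Summit.BirchSwinnertonDyer.BirchSwinnertonDyer.Theorems.GenusSupplyNarrow
  Summit.BirchSwinnertonDyer.BirchSwinnertonDyer.Theorems.GenusSupplyNarrow.DepthZero

variable {K : Type} [Field K] [NumberField K]

/-! ## §1 The frame in `E(K)`-currency -/

/-- **THE SWAP-READ FRAME FOR `Q₀ = P / 2^M` IN `E(K)`.**  `W/ℚ` globally minimal of conductor `N`, `K` imaginary quadratic Heegner for `N`,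
`P ∈ E(K)` a Heegner point, `w(E) = +1`, `E(K)[2] = 0`, `2^M • Q₀ = P` in `E(K)`, and `γ ∈ Γ_ℚ` acting on the tree's copy `e(K) ⊂ ℚ̄` as a
NON-trivial `τ ∈ Aut(K/ℚ)`.  Put `u := τ•Q₀ + Q₀`; `e = e_* = Affine.Point.map (absEmbedding ℚ K) : E(K) →+ E(ℚ̄)` is passed as a binder `(e, he)` so that its values are typed in `W.geomPoints`.  Then: `u` is torsion (`2^M u = τP + P`,
torsion by Gross 5.3 ∕ Darmon 3.11), fixed by `Aut(K/ℚ)` (`τ² = 1`), `τ•Q₀ = −Q₀ + u`; and in `E(ℚ̄)`: **`γ • e_*Q₀ = −e_*Q₀ + e_*u`,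
`γ • e_*u = e_*u`, `addOrderOf (e_*u)` is ODD** (`E(K)[2] = 0`), and **`e_*Q₀ = 2 • w′` for some `w′ ∈ E(ℚ̄)`** (`E(ℚ̄)` is `2`-divisible) —
the hypotheses of `SwapRead.smul_smul_half_eq_add_bit` with `w = e_*Q₀`, `t = e_*u`.
[cite: GrossLMS1991, §5 Prop. 5.3, §4 (4.1)] [cite: Darmon2004, Prop. 3.11] [cite: SilvermanAEC2009, VIII.§1–§2] -/
theorem frame_of_two_pow_smul (W : WeierstrassCurve ℚ) [W.IsElliptic] [W.IsGloballyMinimal] [NeZero (W.conductorNorm ℤ)]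
    (hK : IsImaginaryQuadratic K) (hH : SatisfiesHeegnerHypothesis (W.conductorNorm ℤ) K)
    {P : (W.baseChange K).toAffine.Point} (hP : IsHeegnerPoint (W.conductorNorm ℤ) W K P) (hw1 : W.rootNumber = 1)
    (h2K : ∀ T : (W.baseChange K).toAffine.Point, (2 : ℤ) • T = 0 → T = 0)
    {γ : absoluteGaloisGroup ℚ} {τ : K ≃ₐ[ℚ] K} (hτ1 : τ ≠ 1) (hγ : ∀ x : K, γ • absEmbedding ℚ K x = absEmbedding ℚ K (τ x))
    {M : ℕ} {Q₀ : (W.baseChange K).toAffine.Point} (hQ₀ : ((2 ^ M : ℕ) : ℤ) • Q₀ = P)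
    (e : (W.baseChange K).toAffine.Point →+ W.geomPoints) (he : e = Affine.Point.map (W' := W) (absEmbedding ℚ K)) :
    IsOfFinAddOrder (τ • Q₀ + Q₀) ∧ (∀ σ : K ≃ₐ[ℚ] K, σ • (τ • Q₀ + Q₀) = τ • Q₀ + Q₀) ∧ τ • Q₀ = -Q₀ + (τ • Q₀ + Q₀) ∧
      γ • e Q₀ =
        -e Q₀ +
          e (τ • Q₀ + Q₀) ∧
      γ • e (τ • Q₀ + Q₀) =
        e (τ • Q₀ + Q₀) ∧
      Odd (addOrderOf (e (τ • Q₀ + Q₀))) ∧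
      ∃ w' : W.geomPoints, (2 : ℤ) • w' = e Q₀ := by
  have h2 : Module.finrank ℚ K = 2 := hK.1
  haveI : Algebra.IsQuadraticExtension ℚ K := ⟨h2⟩
  haveI : IsGalois ℚ K := inferInstance
  have hcard : Nat.card (K ≃ₐ[ℚ] K) = 2 := by rw [IsGalois.card_aut_eq_finrank, h2]
  have hττ : τ * τ = 1 := by
    rcases Literature.NumberTheory.QuadraticFields.eq_one_or_eq_of_card_eq_two hcard hτ1 (τ * τ) with h | h
    · exact h
    · exact absurd (mul_left_cancel (a := τ) (h.trans (mul_one τ).symm)) hτ1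
  -- the embedding `e_*`
  have heinj : Function.Injective e := by rw [he]; exact Affine.Point.map_injective (W' := W) _
  have hequiv : ∀ R : (W.baseChange K).toAffine.Point, γ • e R = e (τ • R) := fun R ↦ by
    rw [he]; exact smul_eq_map_absEmbedding_smul W hγ R _ rfl
  -- Gross 5.3 / Darmon 3.11: `t₀ := τP + P` is torsion
  have hσ : (τ : K →ₐ[ℚ] K) ≠ AlgHom.id ℚ K := fun h ↦ hτ1 (AlgEquiv.ext fun x ↦ DFunLike.congr_fun h x)
  have ht₀fin : IsOfFinAddOrder (τ • P + P) := by
    have h := heegnerPoint_conj_add_rootNumber_smul.apply heegnerPoint_conj_add_rootNumber_smul_holds hK hH hP hσ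
    rwa [hw1, one_smul, ← WeierstrassCurve.smul_def W K τ P] at h
  -- `u := τQ₀ + Q₀` has `2^M u = t₀`
  set u : (W.baseChange K).toAffine.Point := τ • Q₀ + Q₀ with hu
  have hτM : τ • (((2 ^ M : ℕ) : ℤ) • Q₀) = ((2 ^ M : ℕ) : ℤ) • (τ • Q₀) := map_zsmul (DistribSMul.toAddMonoidHom _ τ) _ Q₀
  have hMu : ((2 ^ M : ℕ) : ℤ) • u = τ • P + P := by rw [hu, smul_add, ← hτM, hQ₀]
  have hufin : IsOfFinAddOrder u := by
    obtain ⟨n, hn, hnt⟩ := (isOfFinAddOrder_iff_nsmul_eq_zero).mp ht₀fin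
    refine (isOfFinAddOrder_iff_nsmul_eq_zero).mpr ⟨n * 2 ^ M, Nat.mul_pos hn (Nat.pos_of_ne_zero (pow_ne_zero M two_ne_zero)), ?_⟩
    rw [mul_nsmul', ← natCast_zsmul u (2 ^ M), hMu, hnt]
  have hτu : τ • u = u := by
    rw [hu, smul_add, ← mul_smul, hττ, one_smul, add_comm]
  have hfix : ∀ σ : K ≃ₐ[ℚ] K, σ • u = u := by
    intro σ
    rcases Literature.NumberTheory.QuadraticFields.eq_one_or_eq_of_card_eq_two hcard hτ1 σ with rfl | rfl
    · exact one_smul _ _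
    · exact hτu
  have hτQ : τ • Q₀ = -Q₀ + u := by rw [hu]; abel
  -- transport
  have hγQ : γ • e Q₀ = -e Q₀ + e u := by rw [hequiv, hτQ, map_add, map_neg]
  have hγu : γ • e u = e u := by rw [hequiv, hτu]
  have hodd : Odd (addOrderOf (e u)) := by
    refine odd_addOrderOf_of_two_torsionFree (e.isOfFinAddOrder hufin) fun k hk ↦ ?_
    have hk' : e ((2 : ℤ) • (k • u)) = e 0 := by rw [map_zsmul, map_nsmul, hk, map_zero]
    rw [← map_nsmul, h2K _ (heinj hk'), map_zero]
  -- a half of `e Q₀` in `E(ℚ̄)`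
  obtain ⟨w', hw'⟩ := W.zsmul_geomPoints_surjective_holds (two_ne_zero (α := ℤ)) (e Q₀)
  exact ⟨hufin, hfix, hτQ, hγQ, hγu, hodd, ⟨w', hw'⟩⟩

/-! ## §2 The frame in the cruxes' currency -/

/-- **THE SWAP-READ FRAME ON THE POSITIVE-DEPTH CELLS OF THE SUPPLY CRUXES** (23491 / 25504, sign-free).  Habitat-type hypotheses `r_an(E) = 0`
(so `w(E) = +1`, `rootNumber_eq_one_of_even_analyticRank`), `ρ̄_{E,2}` onto and `d_K·Δ_E ∉ ℚ²` (so `E(K[1])[2] = 0`,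
`GenusExact.torsionBy_two_ringClassField_eq_bot`), `K` a Heegner field, a conductor-`1` Kolyvagin–Heegner datum `d₁`, McCallum's divisibility
`2^{M₀} ∣ P(1)` in `E(K[1])`, and `γ ∈ Γ_ℚ` acting on `e(K)` as a non-trivial `τ`.  Then there are `P₀, Q₀ ∈ E(K)` with `P₀` a Heegner point
mapping to `P(1)`, **`2^{M₀} • Q₀ = P₀` in `E(K)`** (McCallum Lemma 5.1), and the §1 frame: with `u := τ•Q₀ + Q₀` — torsion, `Aut(K/ℚ)`-fixed —
`γ • e_*Q₀ = −e_*Q₀ + e_*u`, `γ • e_*u = e_*u`, `addOrderOf (e_*u)` odd, `e_*Q₀ = 2•w′`.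
[cite: GrossLMS1991, §4 (4.1), §5 Prop. 5.3, Lemma 4.3] [cite: McCallumLMS1991, §5 Lemma 5.1] [cite: Darmon2004, Prop. 3.11] -/
theorem frame_of_depth (W : WeierstrassCurve ℚ) [W.IsElliptic] [W.IsGloballyMinimal] [NeZero (W.conductorNorm ℤ)]
    (hK : IsImaginaryQuadratic K) (hH : SatisfiesHeegnerHypothesis (W.conductorNorm ℤ) K)
    (hr0 : W.analyticRank = 0) (hρ : W.HasSurjectiveModNGaloisRep 2) (hsq : ¬ IsSquare ((NumberField.discr K : ℚ) * W.Δ))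
    (Dt : ModularParametrizationData W (W.conductorNorm ℤ)) (β : ℤ) (ι : K →+* ℂ) (d₁ : KolyvaginHeegnerData Dt β ι 1)
    {M₀ : ℕ} (hdiv : ∃ Q : (W.baseChange (ringClassField K ι 1)).toAffine.Point, ((2 ^ M₀ : ℕ) : ℤ) • Q = d₁.derivedPoint)
    {γ : absoluteGaloisGroup ℚ} {τ : K ≃ₐ[ℚ] K} (hτ1 : τ ≠ 1) (hγ : ∀ x : K, γ • absEmbedding ℚ K x = absEmbedding ℚ K (τ x))
    (e : (W.baseChange K).toAffine.Point →+ W.geomPoints) (he : e = Affine.Point.map (W' := W) (absEmbedding ℚ K)) :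
    ∃ P₀ Q₀ : (W.baseChange K).toAffine.Point, IsHeegnerPoint (W.conductorNorm ℤ) W K P₀ ∧
      Affine.Point.map (W' := W) (algebraMap K (ringClassField K ι 1)).toRatAlgHom P₀ = d₁.derivedPoint ∧
      ((2 ^ M₀ : ℕ) : ℤ) • Q₀ = P₀ ∧
      IsOfFinAddOrder (τ • Q₀ + Q₀) ∧ (∀ σ : K ≃ₐ[ℚ] K, σ • (τ • Q₀ + Q₀) = τ • Q₀ + Q₀) ∧
      γ • e Q₀ =
        -e Q₀ +
          e (τ • Q₀ + Q₀) ∧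
      γ • e (τ • Q₀ + Q₀) =
        e (τ • Q₀ + Q₀) ∧
      Odd (addOrderOf (e (τ • Q₀ + Q₀))) ∧
      ∃ w' : W.geomPoints, (2 : ℤ) • w' = e Q₀ := by
  -- `E(K[1])[2] = 0`, hence `E(K)[2] = 0`
  have htors : ∀ T : (W.baseChange (ringClassField K ι 1)).toAffine.Point, (2 : ℤ) • T = 0 → T = 0 := by
    intro T hT
    have h := GenusExact.torsionBy_two_ringClassField_eq_bot W hK ι one_ne_zero hρ hsq
    have hT' : T ∈ AddSubgroup.torsionBy (W.baseChange (ringClassField K ι 1)).toAffine.Point ((2 : ℕ) : ℤ) :=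
      (Submodule.mem_torsionBy_iff _ T).mpr (by exact_mod_cast hT)
    rw [h] at hT'
    exact (AddSubgroup.mem_bot).mp hT'
  set i : (W.baseChange K).toAffine.Point →+ (W.baseChange (ringClassField K ι 1)).toAffine.Point :=
    Affine.Point.map (W' := W) (algebraMap K (ringClassField K ι 1)).toRatAlgHom with hi
  have hiinj : Function.Injective i := Affine.Point.map_injective (W' := W) _
  have h2K : ∀ T : (W.baseChange K).toAffine.Point, (2 : ℤ) • T = 0 → T = 0 := by
    intro T hT
    apply hiinj
    rw [map_zero]
    exact htors _ (by rw [← map_zsmul, hT, map_zero])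
  -- the Heegner point `P₀ ∈ E(K)` under `P(1)`
  obtain ⟨P₀, hP₀H, hP₀⟩ := heegnerSystem_exists_isHeegnerPoint_map_eq_derivedPoint_one
    (heegnerPointOfConductor_one_galoisConj_holds (W.conductorNorm ℤ) W K) hK hH d₁
  -- `w(E) = +1`
  have hw1 : W.rootNumber = 1 := W.rootNumber_eq_one_of_even_analyticRank (by rw [hr0]; exact Even.zero)
  -- McCallum 5.1: `2^{M₀} ∣ y_K` in `E(K)`
  have hdivK : ∃ Q₀ : (W.baseChange K).toAffine.Point, ((2 ^ M₀ : ℕ) : ℤ) • Q₀ = P₀ := by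
    obtain ⟨Q, hQ⟩ := hdiv
    have h := (McCallum1991.exists_pow_smul_eq_derivedPoint_one_iff hK d₁ (p := 2) htors hP₀ M₀).mp
      ⟨Q, by simpa only [Nat.cast_pow, Nat.cast_ofNat] using hQ⟩
    obtain ⟨Q₀, hQ₀⟩ := h
    exact ⟨Q₀, by simpa only [Nat.cast_pow, Nat.cast_ofNat] using hQ₀⟩
  obtain ⟨Q₀, hQ₀⟩ := hdivK
  obtain ⟨hufin, hfix, -, hγQ, hγu, hodd, hw'⟩ := frame_of_two_pow_smul W hK hH hP₀H hw1 h2K hτ1 hγ hQ₀ e he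
  exact ⟨P₀, Q₀, hP₀H, hP₀, hQ₀, hufin, hfix, hγQ, hγu, hodd, hw'⟩

/-! ## §3 Readings at an arithmetic Frobenius acting as `τ` on `K` -/

section Reading

variable {p : ℕ} [Fact p.Prime] {W : WeierstrassCurve ℚ} [W.IsGloballyMinimal] [W.IsElliptic]
  (hΔ : ¬ (p : ℤ) ∣ minimalDiscriminantInt W)
  {𝔓 : Ideal (absIntegers (𝓞 ℚ) ℚ)}
  (hmem : ∀ x : absIntegers (𝓞 ℚ) ℚ, x ∈ 𝔓 ↔ (x : AlgebraicClosure ℚ) ∈ (placeOver p).nonunits)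
  {v : HeightOneSpectrum (𝓞 ℚ)} (hv : (primesEquiv v : ℕ) = p) (h𝔓 : 𝔓 ∈ v.primesAbove)
  {γ : absoluteGaloisGroup ℚ} (hσ : IsArithFrobAt (𝓞 ℚ) γ 𝔓)

include hmem hv h𝔓 hσ in
/-- **THE POSITIVE-DEPTH BIT OF `y_K/2^M`, READ AT A DEEP PRIME'S FROBENIUS** (`E(K)`-frame of §1).  `γ` an arithmetic Frobenius at the place prime
`𝔓 ∣ p`, `p` odd good with `2 ∣ a_p`, acting on `e(K)` as a non-trivial `τ` (as at an inert `p`); `P ∈ E(K)` Heegner, `w(E) = +1`, `E(K)[2] = 0`,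
`2^M • Q₀ = P`; `w′` ANY half of `e_*Q₀`.  Then, with `u = τ•Q₀ + Q₀`:
**`(∃ R ∈ Ẽ(𝔽̄_p), φ²R = R ∧ 2R = red e_*Q₀) ↔ bit(γ; w′, e_*u) = 0`** — «`red_p(y_K/2^M) ∈ 2Ẽ(𝔽_{p²})`» is the bit of p766882.
[cite: GrossLMS1991, §6 Prop. 6.2] [cite: SilvermanAEC2009, Thm. V.2.3.1, Prop. VII.3.1(b)] -/
theorem exists_frobSq_fixed_half_iff_bit_eq_zero_of_frame [NeZero (W.conductorNorm ℤ)]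
    (hp2 : p ≠ 2) (ha : (2 : ℤ) ∣ W.frobeniusTrace p)
    {φ : absoluteGaloisGroup (ZMod p)} (hφ : ∀ x : AlgebraicClosure (ZMod p), φ • x = x ^ p)
    (hK : IsImaginaryQuadratic K) (hH : SatisfiesHeegnerHypothesis (W.conductorNorm ℤ) K)
    {P : (W.baseChange K).toAffine.Point} (hP : IsHeegnerPoint (W.conductorNorm ℤ) W K P) (hw1 : W.rootNumber = 1)
    (h2K : ∀ T : (W.baseChange K).toAffine.Point, (2 : ℤ) • T = 0 → T = 0)
    {τ : K ≃ₐ[ℚ] K} (hτ1 : τ ≠ 1) (hγ : ∀ x : K, γ • absEmbedding ℚ K x = absEmbedding ℚ K (τ x))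
    {M : ℕ} {Q₀ : (W.baseChange K).toAffine.Point} (hQ₀ : ((2 ^ M : ℕ) : ℤ) • Q₀ = P)
    (e : (W.baseChange K).toAffine.Point →+ W.geomPoints) (he : e = Affine.Point.map (W' := W) (absEmbedding ℚ K))
    {w' : W.geomPoints} (hw' : (2 : ℤ) • w' = e Q₀) :
    (∃ R : (reductionModPrime W p).geomPoints, φ • (φ • R) = R ∧
        (2 : ℤ) • R = geomReduction hΔ (e Q₀)) ↔
      γ • (γ • w' + w' - (((addOrderOf (e (τ • Q₀ + Q₀)) + 1) / 2 : ℕ) : ℤ) •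
          e (τ • Q₀ + Q₀)) +
        (γ • w' + w' - (((addOrderOf (e (τ • Q₀ + Q₀)) + 1) / 2 : ℕ) : ℤ) •
          e (τ • Q₀ + Q₀)) = 0 := by
  obtain ⟨-, -, -, hγQ, hγu, hodd, -⟩ := frame_of_two_pow_smul W hK hH hP hw1 h2K hτ1 hγ hQ₀ e he
  exact exists_frobSq_fixed_half_iff_of_even_frobeniusTrace hΔ hmem hv h𝔓 hσ hp2 ha hφ hw' hγQ hγu hodd

include hmem hv h𝔓 hσ in
/-- **BLIND PRIMES, CRUXES' FRAME**: if the Frobenius `γ` (odd good `p`, `2 ∣ a_p`, acting as `τ ≠ 1` on `K`) fixes `E[2]` pointwise — a `τ`-type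
Kolyvagin prime when `Δ_E > 0` — then `red_p(e_*Q₀)`, `2^M Q₀ = P` Heegner, ALWAYS has an `𝔽_{p²}`-rational half: the positive-depth bit cannot be
read there.  (§1 frame + p766882 `exists_frobSq_fixed_half_of_smul_torsion_eq_self`.) [cite: GrossLMS1991, §6 Prop. 6.2] [cite: SilvermanAEC2009, Prop. VII.3.1(b)] -/
theorem exists_frobSq_fixed_half_of_smul_torsion_eq_self_of_frame [NeZero (W.conductorNorm ℤ)]
    (hp2 : p ≠ 2) {φ : absoluteGaloisGroup (ZMod p)} (hφ : ∀ x : AlgebraicClosure (ZMod p), φ • x = x ^ p)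
    (hfixE : ∀ T : W.geomPoints, (2 : ℤ) • T = 0 → γ • T = T)
    (hK : IsImaginaryQuadratic K) (hH : SatisfiesHeegnerHypothesis (W.conductorNorm ℤ) K)
    {P : (W.baseChange K).toAffine.Point} (hP : IsHeegnerPoint (W.conductorNorm ℤ) W K P) (hw1 : W.rootNumber = 1)
    (h2K : ∀ T : (W.baseChange K).toAffine.Point, (2 : ℤ) • T = 0 → T = 0)
    {τ : K ≃ₐ[ℚ] K} (hτ1 : τ ≠ 1) (hγ : ∀ x : K, γ • absEmbedding ℚ K x = absEmbedding ℚ K (τ x))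
    {M : ℕ} {Q₀ : (W.baseChange K).toAffine.Point} (hQ₀ : ((2 ^ M : ℕ) : ℤ) • Q₀ = P)
    (e : (W.baseChange K).toAffine.Point →+ W.geomPoints) (he : e = Affine.Point.map (W' := W) (absEmbedding ℚ K)) :
    ∃ R : (reductionModPrime W p).geomPoints, φ • (φ • R) = R ∧
      (2 : ℤ) • R = geomReduction hΔ (e Q₀) := by
  obtain ⟨-, -, -, hγQ, hγu, hodd, w', hw'⟩ := frame_of_two_pow_smul W hK hH hP hw1 h2K hτ1 hγ hQ₀ e he
  exact exists_frobSq_fixed_half_of_smul_torsion_eq_self hΔ hmem hv h𝔓 hσ hφ hp2 hw' hγQ hγu hodd hfixE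

include hmem hv h𝔓 hσ in
/-- **BLIND PRIMES ON THE POSITIVE-DEPTH CELLS OF THE SUPPLY CRUXES** (cruxes' currency, sign-free): habitat-type hypotheses as in `frame_of_depth`;
`γ` an arithmetic Frobenius of an odd good `p` acting as `τ ≠ 1` on `K` and FIXING `E[2]` pointwise.  Then for the `Q₀ ∈ E(K)` with
`2^{M₀}Q₀ = P₀ ↦ P(1)`: `red_p(e_*Q₀) ∈ 2Ẽ(𝔽_{p²})`.  So on `Δ > 0` the classical `τ`-type deep primes never detect `y_K/2^{M₀}` — the K₄⁺ clause
«Frobenius moves a point of `E[2]`» is forced on any line that reads the positive-depth bit at a deep prime.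
[cite: GrossLMS1991, §4 (4.1), §5 Prop. 5.3, §6 Prop. 6.2] [cite: McCallumLMS1991, §5 Lemma 5.1] -/
theorem exists_frobSq_fixed_half_of_smul_torsion_eq_self_of_depth [NeZero (W.conductorNorm ℤ)]
    (hp2 : p ≠ 2) {φ : absoluteGaloisGroup (ZMod p)} (hφ : ∀ x : AlgebraicClosure (ZMod p), φ • x = x ^ p)
    (hfixE : ∀ T : W.geomPoints, (2 : ℤ) • T = 0 → γ • T = T)
    (hK : IsImaginaryQuadratic K) (hH : SatisfiesHeegnerHypothesis (W.conductorNorm ℤ) K)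
    (hr0 : W.analyticRank = 0) (hρ : W.HasSurjectiveModNGaloisRep 2) (hsq : ¬ IsSquare ((NumberField.discr K : ℚ) * W.Δ))
    (Dt : ModularParametrizationData W (W.conductorNorm ℤ)) (β : ℤ) (ι : K →+* ℂ) (d₁ : KolyvaginHeegnerData Dt β ι 1)
    {M₀ : ℕ} (hdiv : ∃ Q : (W.baseChange (ringClassField K ι 1)).toAffine.Point, ((2 ^ M₀ : ℕ) : ℤ) • Q = d₁.derivedPoint)
    {τ : K ≃ₐ[ℚ] K} (hτ1 : τ ≠ 1) (hγ : ∀ x : K, γ • absEmbedding ℚ K x = absEmbedding ℚ K (τ x))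
    (e : (W.baseChange K).toAffine.Point →+ W.geomPoints) (he : e = Affine.Point.map (W' := W) (absEmbedding ℚ K)) :
    ∃ P₀ Q₀ : (W.baseChange K).toAffine.Point, IsHeegnerPoint (W.conductorNorm ℤ) W K P₀ ∧
      Affine.Point.map (W' := W) (algebraMap K (ringClassField K ι 1)).toRatAlgHom P₀ = d₁.derivedPoint ∧
      ((2 ^ M₀ : ℕ) : ℤ) • Q₀ = P₀ ∧
      ∃ R : (reductionModPrime W p).geomPoints, φ • (φ • R) = R ∧
        (2 : ℤ) • R = geomReduction hΔ (e Q₀) := by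
  obtain ⟨P₀, Q₀, hP₀H, hP₀, hQ₀, -, -, hγQ, hγu, hodd, w', hw'⟩ := frame_of_depth W hK hH hr0 hρ hsq Dt β ι d₁ hdiv hτ1 hγ e he
  exact ⟨P₀, Q₀, hP₀H, hP₀, hQ₀, exists_frobSq_fixed_half_of_smul_torsion_eq_self hΔ hmem hv h𝔓 hσ hφ hp2 hw' hγQ hγu hodd hfixE⟩

end Reading


/-! ## §4 By the sign of `Δ`: Frobenius elements agreeing with complex conjugation on `E[2]` (Gross's (3.2) at level `2`) -/

section Sign

variable {W : WeierstrassCurve ℚ} [W.IsElliptic]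

/-- **`Δ > 0`: an element agreeing with a complex conjugation on `E[2]` FIXES `E[2]` pointwise** (`E[2] ⊂ E(ℝ)`,
`GenusKolySign.twoTorsion_smul_eq_of_Δ_pos`) — the `τ`-type (`FrobEqFrobInfty`) Frobenius class at level `2` on a `Δ > 0` curve.
[cite: SilvermanAEC2009, III.1] [cite: GrossLMS1991, §3 (3.2)] -/
theorem forall_smul_eq_of_agree_of_Δ_pos (hΔ : 0 < W.Δ) {c₀ γ : absoluteGaloisGroup ℚ} (hc₀ : IsComplexConjugation (Rat.castHom ℝ) c₀)
    (hagree : ∀ P : W.geomTorsion 2, γ • P = c₀ • P) :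
    ∀ T : W.geomPoints, (2 : ℤ) • T = 0 → γ • T = T := by
  intro T hT
  have hmem : T ∈ W.geomTorsion 2 := (mem_geomTorsion_iff W 2 T).mpr hT
  have h := hagree ⟨T, hmem⟩
  rw [GenusKolySign.twoTorsion_smul_eq_of_Δ_pos W hΔ hc₀ ⟨T, hmem⟩] at h
  exact congrArg Subtype.val h

/-- **`Δ < 0`: an element agreeing with a complex conjugation on `E[2]` MOVES some `2`-torsion point** (exactly one real `2`-division abscissa,
`KolyvaginEigenTwo.exists_twoTorsion_smul_ne_of_Δ_neg`) — so on K₄ (Δ<0) the classical `τ`-type deep primes ARE of transposition type and the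
Kummer flip of p766882 §2 applies to them. [cite: SilvermanAEC2009, III.1] [cite: GrossLMS1991, §3 (3.2)] -/
theorem exists_smul_ne_of_agree_of_Δ_neg (hΔ : W.Δ < 0) {c₀ γ : absoluteGaloisGroup ℚ} (hc₀ : IsComplexConjugation (Rat.castHom ℝ) c₀)
    (hagree : ∀ P : W.geomTorsion 2, γ • P = c₀ • P) :
    ∃ u : W.geomPoints, (2 : ℤ) • u = 0 ∧ γ • u ≠ u := by
  obtain ⟨v, hv⟩ := KolyvaginEigenTwo.exists_twoTorsion_smul_ne_of_Δ_neg W hΔ hc₀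
  refine ⟨v.1, (mem_geomTorsion_iff W 2 v.1).mp v.2, fun h ↦ hv ?_⟩
  rw [← hagree v]
  exact Subtype.ext h

/-- **BLINDNESS OF `τ`-TYPE ELEMENTS ON `Δ > 0` (abstract frame).**  `Δ_E > 0`, `γ` agreeing with a complex conjugation on `E[2]`, and the frame
`2w′ = w`, `γw = −w + t`, `γt = t`, `t` of odd order: the positive-depth bit VANISHES and `γ²w′ = w′`.  [cite: GrossLMS1991, §3 (3.2), §6 Prop. 6.2] -/
theorem bit_eq_zero_of_agree_of_Δ_pos (hΔ : 0 < W.Δ) {c₀ γ : absoluteGaloisGroup ℚ} (hc₀ : IsComplexConjugation (Rat.castHom ℝ) c₀)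
    (hagree : ∀ P : W.geomTorsion 2, γ • P = c₀ • P) {w w' t : W.geomPoints} (hw' : (2 : ℤ) • w' = w) (hγw : γ • w = -w + t)
    (ht : γ • t = t) (hodd : Odd (addOrderOf t)) :
    γ • (γ • w' + w' - (((addOrderOf t + 1) / 2 : ℕ) : ℤ) • t) + (γ • w' + w' - (((addOrderOf t + 1) / 2 : ℕ) : ℤ) • t) = 0 ∧
      γ • (γ • w') = w' :=
  ⟨bit_eq_zero_of_smul_torsion_eq_self γ (forall_smul_eq_of_agree_of_Δ_pos hΔ hc₀ hagree) hw' hγw hodd,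
    smul_smul_half_eq_self_of_smul_torsion_eq_self γ (forall_smul_eq_of_agree_of_Δ_pos hΔ hc₀ hagree) hw' hγw ht hodd⟩

end Sign

section SignReading

variable {p : ℕ} [Fact p.Prime] {W : WeierstrassCurve ℚ} [W.IsGloballyMinimal] [W.IsElliptic]
  (hΔ : ¬ (p : ℤ) ∣ minimalDiscriminantInt W)
  {𝔓 : Ideal (absIntegers (𝓞 ℚ) ℚ)}
  (hmem : ∀ x : absIntegers (𝓞 ℚ) ℚ, x ∈ 𝔓 ↔ (x : AlgebraicClosure ℚ) ∈ (placeOver p).nonunits)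
  {v : HeightOneSpectrum (𝓞 ℚ)} (hv : (primesEquiv v : ℕ) = p) (h𝔓 : 𝔓 ∈ v.primesAbove)
  {γ : absoluteGaloisGroup ℚ} (hσ : IsArithFrobAt (𝓞 ℚ) γ 𝔓)

include hmem hv h𝔓 hσ in
/-- **ON `Δ > 0` A `τ`-TYPE DEEP PRIME NEVER SEES `y_K/2^{M₀}`** (cruxes' currency).  Habitat-type hypotheses as in `frame_of_depth`, `Δ_E > 0`;
`γ` an arithmetic Frobenius at the place prime over an odd good `p`, acting on `e(K)` as `τ ≠ 1` and agreeing on `E[2]` with a complex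
conjugation (Gross's (3.2) `FrobEqFrobInfty` at level `2`).  Then for the `Q₀ ∈ E(K)` with `2^{M₀}Q₀ = P₀ ↦ P(1)`: **`red_p(e_*Q₀)` has an
`𝔽_{p²}`-rational half.**  The K₄⁺ clause «Frobenius MOVES a point of `E[2]`» is therefore NECESSARY for any reading of the positive-depth bit at a
deep prime when `Δ > 0` (cdisprove 25504 Disproof §2, structure side).  [cite: GrossLMS1991, §3 (3.2), §4 (4.1), §6 Prop. 6.2] [cite: McCallumLMS1991, §5 Lemma 5.1] -/
theorem exists_frobSq_fixed_half_of_agree_of_Δ_pos_of_depth [NeZero (W.conductorNorm ℤ)] (hpos : 0 < W.Δ)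
    (hp2 : p ≠ 2) {φ : absoluteGaloisGroup (ZMod p)} (hφ : ∀ x : AlgebraicClosure (ZMod p), φ • x = x ^ p)
    {c₀ : absoluteGaloisGroup ℚ} (hc₀ : IsComplexConjugation (Rat.castHom ℝ) c₀) (hagree : ∀ P : W.geomTorsion 2, γ • P = c₀ • P)
    (hK : IsImaginaryQuadratic K) (hH : SatisfiesHeegnerHypothesis (W.conductorNorm ℤ) K)
    (hr0 : W.analyticRank = 0) (hρ : W.HasSurjectiveModNGaloisRep 2) (hsq : ¬ IsSquare ((NumberField.discr K : ℚ) * W.Δ))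
    (Dt : ModularParametrizationData W (W.conductorNorm ℤ)) (β : ℤ) (ι : K →+* ℂ) (d₁ : KolyvaginHeegnerData Dt β ι 1)
    {M₀ : ℕ} (hdiv : ∃ Q : (W.baseChange (ringClassField K ι 1)).toAffine.Point, ((2 ^ M₀ : ℕ) : ℤ) • Q = d₁.derivedPoint)
    {τ : K ≃ₐ[ℚ] K} (hτ1 : τ ≠ 1) (hγ : ∀ x : K, γ • absEmbedding ℚ K x = absEmbedding ℚ K (τ x))
    (e : (W.baseChange K).toAffine.Point →+ W.geomPoints) (he : e = Affine.Point.map (W' := W) (absEmbedding ℚ K)) :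
    ∃ P₀ Q₀ : (W.baseChange K).toAffine.Point, IsHeegnerPoint (W.conductorNorm ℤ) W K P₀ ∧
      Affine.Point.map (W' := W) (algebraMap K (ringClassField K ι 1)).toRatAlgHom P₀ = d₁.derivedPoint ∧
      ((2 ^ M₀ : ℕ) : ℤ) • Q₀ = P₀ ∧
      ∃ R : (reductionModPrime W p).geomPoints, φ • (φ • R) = R ∧
        (2 : ℤ) • R = geomReduction hΔ (e Q₀) :=
  exists_frobSq_fixed_half_of_smul_torsion_eq_self_of_depth hΔ hmem hv h𝔓 hσ hp2 hφ
    (forall_smul_eq_of_agree_of_Δ_pos hpos hc₀ hagree) hK hH hr0 hρ hsq Dt β ι d₁ hdiv hτ1 hγ e he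

end SignReading

end Summit.BirchSwinnertonDyer.BirchSwinnertonDyer.Theorems.GenusSupplyNarrow.SwapRead

end
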